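import Summits.CriticalPhenomena.CardyFormulaZ2.Theorems.CardyBoundaryCoulombGasRectilinearCardyClosureDefs
import Summits.CriticalPhenomena.CardyFormulaZ2.Theorems.RectilinearCardy.Negative.RectilinearCardyReductions
import Summits.CriticalPhenomena.CardyFormulaZ2.Theorems.CardyBoundaryCoulombGasRectilinearCardyLocalSide
import HarnessLib

/-!
# Stub stub_orientation of line excursion-kernel-covariance (crux RectilinearCardy,
# stmt-CriticalPhenomena-5660), part 1: the orientation dichotomy at a flat mark

For a conformal rectangle `R = (Ω; a, b, c, d)` with flat marks (`FlatMarks R`: near each marked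
point the frontier lies on the horizontal or on the vertical line through it), the ORIENTATION
DICHOTOMY at the mark `a = pt 0 = ∂Ω(mark 0)` (`orientation_dichotomy_at_pt_zero`, the registered
helper of the stub `stub_orientation`): there are an axis direction `u ∈ {1, i, -1, -i}` and
`r > 0` such that the boundary loop moves strictly forward along `u` for parameters in
`(mark 0 - r, mark 0 + r)` (`Re ((∂Ω(t') - ∂Ω(t)) / u) > 0`, `Im = 0`) and, in the disc `B(a, r)`,
the domain is exactly the open half-disc to the LEFT of `u` (`b = false`,
`{0 < Im ((z - a) / u)}`) or to the RIGHT of `u` (`b = true`).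

Proof. Near `a` the frontier lies on one axis line `a + ℝ d`, `d ∈ {1, i}` (flatness,
`ori_exists_axis_of_flatNear`). The loop is continuous, and injective on parameter intervals of
length `< 1` (`JordanDomain.injOn_boundary_Ico`), so its coordinate along the line is strictly
monotone on a short window (`ContinuousOn.strictMonoOn_of_injOn_Icc'`); `u = ± d` makes it
increasing (`ori_exists_forward_dir`). By the intermediate value theorem the window fills a
sub-segment of the line around `a`; the two open half-discs are convex (images of half-planes
under the isometry `w ↦ a + u w`, `ori_setOf_div_inter_ball`), miss the frontier (flatness) and,
with the segment, cover a small disc, so the Jordan domain fills exactly one of them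
(`carrier_inter_ball_eq_or`, from the Jordan curve theorem). Sources: folklore plane topology;
the line card `Cruxes/RectilinearCardy/Lines/excursion-kernel-covariance.md`.
-/

noncomputable section

open Set Filter Topology MeasureTheory Metric
open Literature.Probability.RandomPlanarGeometry
open Literature.Probability.LatticeModels (Site meshPoint zdGraph)
open Summit.CriticalPhenomena.CardyFormulaZ2.Theorems.RectilinearCardy.Negative (IsRectilinear)

namespace Summit.CriticalPhenomena.CardyFormulaZ2.Cruxes.RectilinearCardy.ExcursionKernelCovariance

/-! ### Elementary facts about axis directions -/

/-- An axis direction has norm one. [folklore] -/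
theorem ori_norm_eq_one {u : ℂ} (hu : u = 1 ∨ u = Complex.I ∨ u = -1 ∨ u = -Complex.I) :
    ‖u‖ = 1 := by
  rcases hu with rfl | rfl | rfl | rfl <;> simp

/-- The rotated frame at `p`: for a unit `u`, the trace on `B(p, r)` of a set described in the
coordinate `(z - p) / u` is the image of the corresponding standard set under `w ↦ p + u w`.
[folklore] -/
theorem ori_setOf_div_inter_ball (P : ℂ → Prop) (p : ℂ) {u : ℂ} (hu : ‖u‖ = 1) (r : ℝ) :
    {z | P ((z - p) / u)} ∩ ball p r = (fun w => p + u * w) '' ({w | P w} ∩ ball 0 r) := by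
  have hu0 : u ≠ 0 := norm_ne_zero_iff.1 (by rw [hu]; exact one_ne_zero)
  ext z
  simp only [mem_inter_iff, mem_setOf_eq, mem_ball, mem_image, dist_zero_right]
  constructor
  · rintro ⟨hP, hd⟩
    refine ⟨(z - p) / u, ⟨hP, ?_⟩, ?_⟩
    · rwa [norm_div, hu, div_one, ← dist_eq_norm]
    · rw [mul_div_cancel₀ _ hu0, add_sub_cancel]
  · rintro ⟨w, ⟨hP, hw⟩, rfl⟩
    have h : (p + u * w - p) / u = w := by rw [add_sub_cancel_left, mul_div_cancel_left₀ _ hu0]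
    refine ⟨by rwa [h], ?_⟩
    rwa [dist_eq_norm, add_sub_cancel_left, norm_mul, hu, one_mul]

/-- Distance from `p` of a point given in the frame `(d, i d)` at `p`, `‖d‖ = 1`. [folklore] -/
theorem ori_dist_frame_lt {p d : ℂ} (hd : ‖d‖ = 1) {s y r : ℝ} (h : |s| + |y| < r) :
    dist (p + (s : ℂ) * d + (y : ℂ) * (Complex.I * d)) p < r := by
  rw [dist_eq_norm, add_assoc, add_sub_cancel_left]
  calc ‖(s : ℂ) * d + (y : ℂ) * (Complex.I * d)‖ ≤ ‖(s : ℂ) * d‖ + ‖(y : ℂ) * (Complex.I * d)‖ :=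
        norm_add_le _ _
    _ = |s| + |y| := by simp [hd]
    _ < r := h

/-- Frame coordinates: `((p + s d + y i d) - p) / d = s + y i` for `d ≠ 0`. [folklore] -/
theorem ori_frame_div {p d : ℂ} (hd : d ≠ 0) (s y : ℂ) :
    (p + s * d + y * (Complex.I * d) - p) / d = s + y * Complex.I := by
  field_simp
  ring

/-! ### Part (i): the orientation dichotomy at the flat mark `a = pt 0` -/

/-- Flatness near `z₀` read in a frame: there is `d ∈ {1, i}` such that every frontier point within
`r₀` of `z₀` has `((z - z₀) / d).im = 0`. [folklore] -/
theorem ori_exists_axis_of_flatNear {R : ConformalRectangle} {z₀ : ℂ} {r₀ : ℝ}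
    (h : FlatNear R z₀ r₀) : ∃ d : ℂ, (d = 1 ∨ d = Complex.I) ∧
      ∀ z ∈ frontier R.carrier, dist z z₀ < r₀ → ((z - z₀) / d).im = 0 := by
  rcases h with h | h
  · exact ⟨1, Or.inl rfl, fun z hz hd => by simp [h z hz hd]⟩
  · exact ⟨Complex.I, Or.inr rfl, fun z hz hd => by simp [Complex.div_I, h z hz hd]⟩

/-- **Forward direction of the loop at a flat mark.** For a conformal rectangle with flat marks
there are an axis direction `u`, a flatness radius `r₀` (every frontier point within `r₀` of
`a = pt 0` lies on the line `a + ℝ u`) and a parameter window `[mark 0 - η, mark 0 + η]` mapped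
into `B(a, r₀)` on which the coordinate `Re ((∂Ω(t) - a) / u)` is strictly increasing (the loop is
continuous and injective on parameter intervals of length `< 1`). [folklore] -/
theorem ori_exists_forward_dir (R : ConformalRectangle) (hR : FlatMarks R) :
    ∃ u : ℂ, (u = 1 ∨ u = Complex.I ∨ u = -1 ∨ u = -Complex.I) ∧ ∃ r₀ : ℝ, 0 < r₀ ∧
      (∀ z ∈ frontier R.carrier, dist z (R.pt 0) < r₀ → ((z - R.pt 0) / u).im = 0) ∧
      ∃ η : ℝ, 0 < η ∧
        (∀ t ∈ Icc (R.mark 0 - η) (R.mark 0 + η), dist (R.boundary t) (R.pt 0) < r₀) ∧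
        StrictMonoOn (fun t => ((R.boundary t - R.pt 0) / u).re)
          (Icc (R.mark 0 - η) (R.mark 0 + η)) := by
  obtain ⟨r₀, hr₀, hflat⟩ := hR 0
  obtain ⟨d, hd, hline⟩ := ori_exists_axis_of_flatNear hflat
  have hd0 : d ≠ 0 := by rcases hd with rfl | rfl <;> simp
  set p := R.pt 0 with hp
  set μ := R.mark 0 with hμ
  have hpμ : R.boundary μ = p := rfl
  -- continuity window
  obtain ⟨η₀, hη₀, hη₀r⟩ : ∃ η₀ > 0, ∀ ⦃t : ℝ⦄, dist t μ < η₀ → dist (R.boundary t) p < r₀ := by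
    have h := Metric.continuousAt_iff.1 (R.continuous_boundary.continuousAt (x := μ)) r₀ hr₀
    rwa [hpμ] at h
  set η := min η₀ 1 / 4 with hηdef
  have hη : 0 < η := by rw [hηdef]; positivity
  have hηη₀ : η < η₀ := by
    rw [hηdef]; have := min_le_left η₀ 1; linarith
  have hη1 : 2 * η < 1 := by
    rw [hηdef]; have := min_le_right η₀ 1; linarith
  have hwin : ∀ t ∈ Icc (μ - η) (μ + η), dist (R.boundary t) p < r₀ := fun t ht =>
    hη₀r (by rw [Real.dist_eq, abs_lt]; constructor <;> linarith [ht.1, ht.2])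
  -- the coordinate along `d`
  set c : ℝ → ℝ := fun t => ((R.boundary t - p) / d).re with hc
  have hc_cont : Continuous c := by
    rw [hc]
    exact Complex.continuous_re.comp ((R.continuous_boundary.sub continuous_const).div_const d)
  have hc_eq : ∀ t ∈ Icc (μ - η) (μ + η), (R.boundary t - p) / d = (c t : ℂ) := fun t ht =>
    Complex.ext (by simp [hc]) (by
      rw [Complex.ofReal_im]; exact hline _ (R.boundary_mem_frontier t) (hwin t ht))
  have hsub : Icc (μ - η) (μ + η) ⊆ Ico (μ - η) (μ - η + 1) := fun t ht =>
    ⟨ht.1, by linarith [ht.2]⟩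
  have hinj : InjOn R.boundary (Icc (μ - η) (μ + η)) := (R.injOn_boundary_Ico (μ - η)).mono hsub
  have hc_inj : InjOn c (Icc (μ - η) (μ + η)) := by
    intro t ht t' ht' h
    refine hinj ht ht' ?_
    have h2 : (R.boundary t - p) / d = (R.boundary t' - p) / d := by
      rw [hc_eq t ht, hc_eq t' ht', h]
    rwa [div_left_inj' hd0, sub_left_inj] at h2
  rcases hc_cont.continuousOn.strictMonoOn_of_injOn_Icc' (by linarith) hc_inj with hmono | hanti
  · exact ⟨d, hd.elim Or.inl fun h => Or.inr (Or.inl h), r₀, hr₀, hline, η, hη, hwin, hmono⟩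
  · refine ⟨-d, ?_, r₀, hr₀, fun z hz hzr => ?_, η, hη, hwin, fun t ht t' ht' htt' => ?_⟩
    · rcases hd with rfl | rfl
      · exact Or.inr (Or.inr (Or.inl rfl))
      · exact Or.inr (Or.inr (Or.inr rfl))
    · rw [div_neg, Complex.neg_im, hline z hz hzr, neg_zero]
    · simp only [div_neg, Complex.neg_re]
      exact neg_lt_neg (hanti ht ht' htt')

/-- **The orientation dichotomy at the flat mark `a = pt 0`** (part (i) of the stub
`stub_orientation`, registered helper): an axis
direction `u`, a radius `r > 0`, strict forward motion of the loop along `u` on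
`(mark 0 - r, mark 0 + r)`, and the domain filling exactly the left (`b = false`) or the right
(`b = true`) open half-disc of `B(a, r)`. [folklore] -/
theorem orientation_dichotomy_at_pt_zero (R : ConformalRectangle) (hR : FlatMarks R) :
    ∃ b : Bool, ∃ u : ℂ, (u = 1 ∨ u = Complex.I ∨ u = -1 ∨ u = -Complex.I) ∧ ∃ r : ℝ, 0 < r ∧
      (∀ t t' : ℝ, R.mark 0 - r < t → t < t' → t' < R.mark 0 + r →
        0 < ((R.boundary t' - R.boundary t) / u).re ∧
          ((R.boundary t' - R.boundary t) / u).im = 0) ∧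
      (∀ z : ℂ, dist z (R.pt 0) < r →
        (z ∈ R.carrier ↔ 0 < (if b then -((z - R.pt 0) / u).im else ((z - R.pt 0) / u).im))) := by
  obtain ⟨u, hu, r₀, hr₀, hline, η, hη, hwin, hmono⟩ := ori_exists_forward_dir R hR
  have hu1 : ‖u‖ = 1 := ori_norm_eq_one hu
  have hu0 : u ≠ 0 := norm_ne_zero_iff.1 (by rw [hu1]; exact one_ne_zero)
  set p := R.pt 0 with hp
  set μ := R.mark 0 with hμ
  have hpμ : R.boundary μ = p := rfl
  set e : ℝ → ℝ := fun t => ((R.boundary t - p) / u).re with he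
  have he_cont : Continuous e := by
    rw [he]
    exact Complex.continuous_re.comp ((R.continuous_boundary.sub continuous_const).div_const u)
  have heμ : e μ = 0 := by simp [he, hpμ]
  have hμmem : μ ∈ Icc (μ - η) (μ + η) := ⟨by linarith, by linarith⟩
  have he_eq : ∀ t ∈ Icc (μ - η) (μ + η), R.boundary t = p + (e t : ℂ) * u := by
    intro t ht
    have h1 : (R.boundary t - p) / u = (e t : ℂ) :=
      Complex.ext (by simp [he]) (by
        rw [Complex.ofReal_im]; exact hline _ (R.boundary_mem_frontier t) (hwin t ht))
    rw [← h1, div_mul_cancel₀ _ hu0, add_sub_cancel]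
  -- the two ends of the window
  have heL : e (μ - η) < 0 := heμ ▸ hmono ⟨le_rfl, by linarith⟩ hμmem (by linarith)
  have heR : 0 < e (μ + η) := heμ ▸ hmono hμmem ⟨by linarith, le_rfl⟩ (by linarith)
  -- filling of the segment
  have hfill : ∀ s ∈ Icc (e (μ - η)) (e (μ + η)), p + (s : ℂ) * u ∈ frontier R.carrier := by
    intro s hs
    obtain ⟨t, ht, hts⟩ := intermediate_value_Icc (by linarith) he_cont.continuousOn hs
    rw [← hts, ← he_eq t ht]
    exact R.boundary_mem_frontier t
  -- the radius
  set r := min (min η r₀) (min (-e (μ - η)) (e (μ + η))) with hrdef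
  have hr : 0 < r := lt_min (lt_min hη hr₀) (lt_min (by linarith) heR)
  have hrη : r ≤ η := (min_le_left _ _).trans (min_le_left _ _)
  have hrr₀ : r ≤ r₀ := (min_le_left _ _).trans (min_le_right _ _)
  have hrL : r ≤ -e (μ - η) := (min_le_right _ _).trans (min_le_left _ _)
  have hrR : r ≤ e (μ + η) := (min_le_right _ _).trans (min_le_right _ _)
  -- forward motion
  have hfwd : ∀ t t' : ℝ, μ - r < t → t < t' → t' < μ + r →
      0 < ((R.boundary t' - R.boundary t) / u).re ∧
        ((R.boundary t' - R.boundary t) / u).im = 0 := by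
    intro t t' h1 h2 h3
    have ht : t ∈ Icc (μ - η) (μ + η) := ⟨by linarith, by linarith⟩
    have ht' : t' ∈ Icc (μ - η) (μ + η) := ⟨by linarith, by linarith⟩
    have h4 : (R.boundary t' - R.boundary t) / u = ((e t' - e t : ℝ) : ℂ) := by
      rw [he_eq t ht, he_eq t' ht', Complex.ofReal_sub]
      field_simp
      ring
    rw [h4, Complex.ofReal_re, Complex.ofReal_im]
    exact ⟨sub_pos.2 (hmono ht ht' h2), rfl⟩
  -- the local side
  have h₁ : IsPreconnected ({z | 0 < ((z - p) / u).im} ∩ ball p r) := by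
    rw [ori_setOf_div_inter_ball (fun w => 0 < w.im) p hu1 r]
    exact ((convex_halfSpace_im_gt 0).inter (convex_ball 0 r)).isPreconnected.image _
      (by fun_prop)
  have h₂ : IsPreconnected ({z | ((z - p) / u).im < 0} ∩ ball p r) := by
    rw [ori_setOf_div_inter_ball (fun w => w.im < 0) p hu1 r]
    exact ((convex_halfSpace_im_lt 0).inter (convex_ball 0 r)).isPreconnected.image _
      (by fun_prop)
  have hcover : ball p r ⊆ {z | 0 < ((z - p) / u).im} ∪ {z | ((z - p) / u).im < 0} ∪
      frontier R.carrier := by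
    intro z hz
    rw [mem_ball] at hz
    rcases lt_trichotomy 0 ((z - p) / u).im with h | h | h
    · exact Or.inl (Or.inl h)
    · right
      set s := ((z - p) / u).re with hs
      have hzs : (z - p) / u = (s : ℂ) := Complex.ext (by simp [hs]) (by simp [← h])
      have hsn : |s| < r := by
        have h5 : ‖(z - p) / u‖ = dist z p := by rw [norm_div, hu1, div_one, dist_eq_norm]
        rw [hzs, Complex.norm_real, Real.norm_eq_abs] at h5
        rwa [h5]
      have hz' : z = p + (s : ℂ) * u := by rw [← hzs, div_mul_cancel₀ _ hu0, add_sub_cancel]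
      rw [hz']
      exact hfill s ⟨by linarith [(abs_lt.1 hsn).1], by linarith [(abs_lt.1 hsn).2]⟩
    · exact Or.inl (Or.inr h)
  have hP₁ : ∀ z ∈ {z | 0 < ((z - p) / u).im}, dist z p < r → z ∉ frontier R.carrier :=
    fun z hz hd hf => (ne_of_gt hz) (hline z hf (lt_of_lt_of_le hd hrr₀))
  have hP₂ : ∀ z ∈ {z | ((z - p) / u).im < 0}, dist z p < r → z ∉ frontier R.carrier :=
    fun z hz hd hf => (ne_of_lt hz) (hline z hf (lt_of_lt_of_le hd hrr₀))
  rcases carrier_inter_ball_eq_or R.toJordanDomain (b := p) (R.pt_mem_frontier 0) h₁ h₂ hcover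
    hP₁ hP₂ with h | h
  · refine ⟨false, u, hu, r, hr, hfwd, fun z hz => ?_⟩
    have h6 := Set.ext_iff.1 h z
    simp only [mem_inter_iff, mem_ball, hz, and_true, mem_setOf_eq] at h6
    simpa using h6
  · refine ⟨true, u, hu, r, hr, hfwd, fun z hz => ?_⟩
    have h6 := Set.ext_iff.1 h z
    simp only [mem_inter_iff, mem_ball, hz, and_true, mem_setOf_eq] at h6
    simpa using h6

end Summit.CriticalPhenomena.CardyFormulaZ2.Cruxes.RectilinearCardy.ExcursionKernelCovariance

end
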